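import Mathlib
import HarnessLib
import Summits.QuantumFields.QCD.Theses.QuarksAsStableAction
import Summits.QuantumFields.QCD.Theses.WilsonQuarkChessboard

/-!
# Sketch — crux idea `chessboard-cell-gain` for crux stmt-QuantumFields-9734
(`QuarksAsStableAction.CriticalLineDiamagnetism`), ideator k = 2, round 1.

First lemmas of the line "quark chessboard (sibling item stmt-9306) + perturbative one-cell gain +
Hadamard per bad cell ⇒ CriticalLineDiamagnetism on even tori".  Statements only (no proofs are
claimed here); everything elaborates over existing declarations.
-/

namespace Summit.QuantumFields.QCD.Cruxes.CriticalLineDiamagnetism.ChessboardCellGain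

open Literature.MathematicalPhysics.QuantumFieldTheory Literature.MathematicalPhysics.QuantumLattice
open scoped BigOperators Classical Matrix ComplexOrder

noncomputable section

/-- The colour group of the engine: `U(3)` (tiles and twists of `SU(3)` fields live here). -/
abbrev U3 : Type := Matrix.unitaryGroup (Fin 3) ℂ

/-- All-axes antiperiodic `r = 1` Wilson determinant of a `U(3)` field (seam on the links leaving
`x_μ = L - 1`), literally the `dAP` of `WilsonQuarkChessboard.QuarkChessboard`. -/
def dAP {L : ℕ} [NeZero L] (V : GaugeConfig 4 L U3) (m : ℝ) : ℂ :=
  (wilsonDirac (unitaryFundamentalRep (Fin 3) ℂ)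
    (fun e => if (e.1 e.2).val + 1 = L then -V e else V e) m 1).det

/-- Period-2 site-reflection tiling of the torus by the closed unit cell with lowest corner `c`,
literally the `tile` of `WilsonQuarkChessboard.QuarkChessboard`. -/
def tile {L : ℕ} [NeZero L] (c : Site 4 L) (V : GaugeConfig 4 L U3) : GaugeConfig 4 L U3 :=
  fun e => if (e.1 e.2 - c e.2).val % 2 = 0 then
      V (fun ν => c ν + (((e.1 ν - c ν).val % 2 : ℕ) : ZMod L), e.2)
    else (V (fun ν => c ν + (((Site.shift e.1 e.2 ν - c ν).val % 2 : ℕ) : ZMod L), e.2))⁻¹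

/-- Plaquette deficit `3 - Re tr V_p` of a `U(3)` field. -/
def dfc {L : ℕ} [NeZero L] (V : GaugeConfig 4 L U3) (p : Plaquette 4 L) : ℝ :=
  3 - (unitaryFundamentalRep (Fin 3) ℂ (plaquetteHolonomy V p.1 p.2.1.1 p.2.1.2)).trace.re

/-- **First lemma of the line (load-bearing, new): perturbative ONE-CELL GAIN.**  There is a
perturbative radius `δ₀` such that every reflection tiling all of whose plaquettes are `δ₀`-good has
its antiperiodic Wilson determinant below the free one by `exp(-c · S_W(tiling))` up to an `O(1)`
constant, uniformly in the (even) volume and in `|m| ≤ ε`: second-order expansion of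
`log det` around the flat tiling in a cell-axial gauge = the one-loop Wilson vacuum polarisation at
the sixteen period-2 momenta `q ∈ {0, π}⁴` (screening sign, minimum `+0.0063 K_W` at the corner),
third-order remainder `O(S^{3/2})`, and the Bloch momenta `|θ| ≲ S^{1/2}` near the free zero mode
paid by `O(S² log(1/S))`. -/
def CellGain : Prop :=
  ∃ δ₀ c K₀ ε : ℝ, 0 < δ₀ ∧ 0 < c ∧ 0 < ε ∧ ∃ L₀ : ℕ, ∀ (L : ℕ) [NeZero L], Even L → L₀ ≤ L →
    ∀ (V : GaugeConfig 4 L U3) (cell : Site 4 L) (m : ℝ), |m| ≤ ε →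
      (∀ p : Plaquette 4 L, dfc (tile cell V) p < δ₀) →
        (dAP (tile cell V) m).re ≤
          Real.exp (K₀ - c * ∑ p : Plaquette 4 L, dfc (tile cell V) p) * ‖dAP (1 : GaugeConfig 4 L U3) m‖

/-- **Support (provable now): Hadamard per cell.** Any `U(3)` field's antiperiodic determinant is
at most `exp(h L⁴)` times the free one near `m = 0` (row-norm Hadamard bound above; the free
antiperiodic determinant is `∏_p [(m + Σ(1 - cos p_μ))² + Σ sin² p_μ]⁶ ≥ e^{-h' L⁴}` below, the
`log`-singularity at `p → 0` being integrable in four dimensions). -/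
def HadamardCell : Prop :=
  ∃ h ε : ℝ, 0 < ε ∧ ∃ L₀ : ℕ, ∀ (L : ℕ) [NeZero L], L₀ ≤ L →
    ∀ (V : GaugeConfig 4 L U3) (m : ℝ), |m| ≤ ε →
      ‖dAP V m‖ ≤ Real.exp (h * (L : ℝ) ^ 4) * ‖dAP (1 : GaugeConfig 4 L U3) m‖

/-- The crux `CriticalLineDiamagnetism` restricted to EVEN tori (verbatim signature with
`Even L →` inserted): what the chessboard line proves. -/
def CriticalLineDiamagnetismEven : Prop :=
  ∃ ε δ c₁ K C : ℝ, 0 < ε ∧ 0 < δ ∧ 0 < c₁ ∧ ∃ L₀ : ℕ, ∀ (L : ℕ) [NeZero L], L₀ ≤ L → Even L → let apDet : Literature.MathematicalPhysics.QuantumFieldTheory.GaugeConfig 4 L (Matrix.specialUnitaryGroup (Fin 3) ℂ) → ℝ → ℂ := fun U m => Literature.MathematicalPhysics.QuantumLattice.fermionDet (Literature.MathematicalPhysics.QuantumLattice.wilsonDirac (Literature.MathematicalPhysics.QuantumLattice.unitaryFundamentalRep (Fin 3) ℂ) (fun e => if e.1 e.2 = -1 then -(⟨(U e).1, Matrix.specialUnitaryGroup_le_unitaryGroup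 (U e).2⟩ : Matrix.unitaryGroup (Fin 3) ℂ) else ⟨(U e).1, Matrix.specialUnitaryGroup_le_unitaryGroup (U e).2⟩) m 1); let dfc : Literature.MathematicalPhysics.QuantumFieldTheory.GaugeConfig 4 L (Matrix.specialUnitaryGroup (Fin 3) ℂ) → Literature.MathematicalPhysics.QuantumFieldTheory.Plaquette 4 L → ℝ := fun U p => 3 - (Literature.MathematicalPhysics.QuantumLattice.fundamentalRep (Fin 3) (Literature.MathematicalPhysics.QuantumFieldTheory.plaquetteHolonomy U p.1 p.2.1.1 p.2.1.2)).trace.re; ∀ m : ℝ, |m| ≤ ε → ∀ U : Literature.MathematicalPhysics.QuantumFieldTheory.GaugeConfig 4 L (Matrix.specialUnitaryGroup (Fin 3) ℂ), ‖apDet U m‖ ≤ Real.exp (K - c₁ * (∑ p ∈ Finset.univ.filter (fun p => dfc U p < δ), dfc U p) + C * ((Finset.univ.filter (fun p => δ ≤ dfc U p)).card : ℝ)) * ‖apDet 1 m‖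

/-- **The reduction the line must prove (kernel-checked composition of a later skeleton):**
quark chessboard (shared item stmt-9306 of route WilsonQuarkChessboard) + one-cell gain + Hadamard
per bad cell give the crux on even tori, with `δ := δ₀`, `c₁ := c`, `C := 4h + 24 c δ₀`, `K := K₀`
(each plaquette lies in 4 closed unit cells; a cell is spoiled only by a bad plaquette inside it). -/
def Reduction : Prop :=
  Theses.WilsonQuarkChessboard.QuarkChessboard → CellGain → HadamardCell → CriticalLineDiamagnetismEven

/-- The honest residual of the line: the crux quantifies over ALL `L ≥ L₀`, reflection positivity
pairs hyperplanes only on even tori.  Either an odd-torus device or a planner restatement of the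
crux to even tori (route A and the bridge B already live on even tori) closes it. -/
def OddTransfer : Prop :=
  CriticalLineDiamagnetismEven → Theses.QuarksAsStableAction.CriticalLineDiamagnetism

/-- Sanity: the two items glue to the crux by modus ponens. -/
theorem crux_of (hC : Theses.WilsonQuarkChessboard.QuarkChessboard) (hG : CellGain)
    (hH : HadamardCell) (hR : Reduction) (hT : OddTransfer) :
    Theses.QuarksAsStableAction.CriticalLineDiamagnetism :=
  hT (hR hC hG hH)


/-! ## Second idea `schatten-holder-all-tori`: Hölder on Lüscher's closed-slab transfer matrices

The finite-dimensional trace inequalities that replace the Fröhlich–Lieb maximiser argument and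
reach ODD extents.  `T t` are the closed-slab transfer matrices of an arbitrary background (one per
slice, `A_t† G_t A_{t+1}` in Lüscher's form); `Tᴴ T` is the transfer matrix of the reflection-doubled
slab, so `Tr ((T t)ᴴ * T t) ^ n` is the antiperiodic partition function of the period-2 reflection
tiling by slab `t` on a time-circle of EVEN length `2n`. -/

/-- **Schatten–Hölder, even extent** (generalised Hölder `‖T₁⋯T_L‖₁ ≤ ∏ ‖T_t‖_{S_L}` with
`‖T‖_{S_L}^L = Tr (TᴴT)^{L/2}`): for an even number `L = 2n` of factors,
`|Tr (T₀ ⋯ T_{L-1})|^L ≤ ∏_t Re Tr ((T_tᴴ T_t)^n)`.  Pure matrix analysis (Bhatia IV.2, Simon,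
Trace Ideals Thm 2.8); natural powers only. -/
def SchattenHolderEven : Prop :=
  ∀ (d n : ℕ) (T : Fin (2 * n) → Matrix (Fin d) (Fin d) ℂ), 0 < n →
    ‖((List.ofFn T).prod).trace‖ ^ (2 * n) ≤
      ∏ t : Fin (2 * n), (((T t)ᴴ * T t) ^ n).trace.re

/-- **Schatten–Hölder + midpoint log-convexity, odd extent**: for `L = 2n + 1` factors,
`|Tr (T₀ ⋯ T_{L-1})|^{2L} ≤ ∏_t Re Tr ((T_tᴴT_t)^n) · Re Tr ((T_tᴴT_t)^{n+1})`
(Hölder as above, then `Σ σ^{L} = Σ σ^{(L-1)/2} σ^{(L+1)/2} ≤ (Σ σ^{L-1})^{1/2} (Σ σ^{L+1})^{1/2}`):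
the two traces on the right are partition functions on time-circles of the EVEN lengths `L ∓ 1`. -/
def SchattenHolderOdd : Prop :=
  ∀ (d n : ℕ) (T : Fin (2 * n + 1) → Matrix (Fin d) (Fin d) ℂ), 0 < n →
    ‖((List.ofFn T).prod).trace‖ ^ (2 * (2 * n + 1)) ≤
      ∏ t : Fin (2 * n + 1), (((T t)ᴴ * T t) ^ n).trace.re * (((T t)ᴴ * T t) ^ (n + 1)).trace.re

/-- Sanity instance of the odd inequality with one factor-pair structure visible: for a single
normal step it is Cauchy–Schwarz on the spectrum.  (Statement only.) -/
def MidpointLogConvex : Prop :=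
  ∀ (d n : ℕ) (P : Matrix (Fin d) (Fin d) ℂ), P.PosSemidef →
    ((P ^ (2 * n + 1)).trace.re) ^ 2 ≤ (P ^ (2 * n)).trace.re * (P ^ (2 * n + 2)).trace.re

end

end Summit.QuantumFields.QCD.Cruxes.CriticalLineDiamagnetism.ChessboardCellGain
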